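import Literature.NumberTheory.LFunctions.WeilGroundStateRealZeros
import HarnessLib

/-!
# Small windows of Weil's quadratic form — Suzuki 2026 (screw-function approach): named facts

Literature/NumberTheory/LFunctions. M. Suzuki, *Weil's quadratic form via the screw function*,
arXiv:2606.09096 (June 2026, UNREFEREED — tagged `@[claim … "under-review"]`), studies the localisation
`Q_W^a := Q_W|_{L²(-a,a)}` of Weil's quadratic form `Q_W(v) := W(v ∗ ṽ)` through the screw function of `ζ`.

## Normalisation check (read pp. 2–5 of the held text)
Suzuki's functional (p. 2) is
`W(f) = ∫ f(x)(e^{x/2} + e^{-x/2})dx − Σ Λ(n)n^{-1/2}(f(log n) + f(−log n)) − (log 4π + γ) f(0)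
        − ∫₀^∞ {f(x) + f(−x) − 2e^{−x/2} f(0)} e^{x/2} dx/(eˣ − e^{−x})`,
i.e. Bombieri's form: polar `ĝ(0) + ĝ(1)` (`weilPolarTerm`), prime term (`weilPrimeTerm`), and
`weilArchTermBombieri` (`[e^{x/2}(f(x)+f(−x)) − 2f(0)]/(2 sinh x)`), so `W = weilFunctional` on test functions
(`weilArchTermBombieri_eq_weilArchTerm`); `(v₁ ∗ v₂)(x) = ∫ v₁(y)v₂(x−y)dy = weilConv`, `ṽ(x) = conj v(−x) = weilReflect`,
hence `Q_W(v) = weilQuadratic v`; and `C_c^∞(−a,a) := {v ∈ C_c^∞(ℝ) | supp v ⊆ [−a,a]}` (p. 2) is exactly the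
tree's class `IsWeilTest v ∧ tsupport v ⊆ Icc (-a) a`. By Cor. 1.2, `λ_a` (the bottom of the spectrum of the
self-adjoint operator `A_a` of `Q_W^a`, [CCM25]) "is the infimum of the Rayleigh quotient over `C_c^∞(−a,a)`",
i.e. `λ_a = weilGroundEnergy a` (homogeneity `Q(cv) = |c|²Q(v)`).

## What is vendored (statements only; users take `(h : <Fact>)`)
* `Suzuki2026_thm_1_3` — Thm. 1.3: "The lowest eigenvalue `λ_a` is continuous in `a`" (`a > 0`).
* `Suzuki2026_thm_1_4` — Thm. 1.4: for sufficiently small `a > 0`, `λ_a` is positive, SIMPLE, and the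
  corresponding eigenfunction is EVEN; rendered variationally as `0 < weilGroundEnergy a ∧ WeilWindowSimpleEven a`
  through min–max and the discreteness of the spectrum of `A_a` ([CCM25], quoted by Suzuki p. 4: "bounded from
  below and discrete, with `+∞` as its only accumulation point"): with `v_a` the even ground state and
  `λ₂(a) > λ_a` the next spectral point, every `v` in the form domain orthogonal to `v_a` — in particular every
  ODD test function and every EVEN test function with `∫ conj v_a · v = 0` — has `Q(v) ≥ λ₂‖v‖²`; take
  `φ := v_a`, `δ := λ₂ − λ_a`.
* `Suzuki2026_thm_1_4_asymptotic` — the printed expansion `λ_a = log(1/a) + μ₁ − log(2π) + ψ(2) − 1 + O(a)`,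
  `μ₁ > 0` (`ψ(2) − 1 = −γ`).
* `Suzuki2026_thm_1_4.smallWindowsSimpleEven` — PROVED corollary: the fact gives
  `∃ a₀ > 0, ∀ a ∈ (0, a₀], WeilWindowSimpleEven a`, which is verbatim the route item
  `Summit.RiemannHypothesis.RiemannHypothesis.Theses.WeilGroundState.SmallWindowsSimpleEven`
  (`weilWindowSimpleEven_iff` is `Iff.rfl`).

Suzuki's proof of Thm. 1.4 (§4–§5): rescale the window to `(−1,1)`; the Rayleigh quotient is
`R(a,v) = log(1/a) − (2A+1) + 𝓛(v)/‖v‖² + O(a)` with the scale-free form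
`𝓛(u,v) = ¼∬_{(−1,1)²}(u(x)−u(y))conj(v(x)−v(y))/|x−y| dxdy − ½∫ u conj v · log(1−x²)dx` (jump kernel `|x−y|^{-1}`,
killing `−log(1−x²) ≥ 0`), a regular irreducible Dirichlet form (Beurling–Deny, [FOT11], [LSV09]) whose semigroup
is positivity improving, so its bottom is simple with an a.e. positive (hence even) eigenfunction; a finite-rank
perturbation argument transfers simplicity and evenness to `A_a` for small `a`. This is the mechanism of the
route's support items `MarkovPartPositiveGroundState` / `SmallWindowsSimpleEven` (route WeilGroundState), now in print.

Deliberately NOT here: Thm. 1.1 (`A_a` is the Friedrichs extension of `B_a = D* G_a D`), Thm. 1.5 (the entire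
function `W(a,θ;z)` with only real zeros), Cor. 1.6 (a conditional route to RH through
`lim e^{φ} W(a,θ;z) = z² ξ(½−iz)/ξ′(½−iz)`), and the conjectural limit formula (1.2)
`lim_{a→∞} c_a v̂_a(z) = ξ(½+iz)` of [CCM25] (an OPEN statement, cf. the route crux `GroundStatesConvergeToXi`).

## References
* M. Suzuki, *Weil's quadratic form via the screw function*, arXiv:2606.09096 (2026). (key `Suzuki2026`)
* A. Connes, C. Consani, H. Moscovici, *Zeta spectral triples*, arXiv:2511.22755 (2025) = [CCM25].
  (key `ConnesConsaniMoscovici2025`)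
* A. Connes, W. D. van Suijlekom, Comm. Math. Phys. 406 (2025), Thm. 6.1. (key `ConnesSuijlekom2025`)
* H. Yoshida, *On Hermitian forms attached to zeta functions* (1992): `λ_a > 0` for small `a`.
-/

noncomputable section

open Set Filter MeasureTheory
open scoped Topology

namespace Literature.NumberTheory.LFunctions

/-- CLAIM (**Suzuki 2026, Thm. 1.3**, arXiv:2606.09096, unrefereed): "The lowest eigenvalue `λ_a` is continuous
in `a`." Here `λ_a = inf_{0 ≠ v ∈ C_c^∞(−a,a)} Q_W(v)/‖v‖² = weilGroundEnergy a` (Cor. 1.2 and the normalisation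
check in the module docstring), for windows `a > 0`. -/
@[claim "Suzuki2026" "under-review"]
def Suzuki2026_thm_1_3 : Prop :=
  ContinuousOn weilGroundEnergy (Ioi (0 : ℝ))

/-- CLAIM (**Suzuki 2026, Thm. 1.4**, arXiv:2606.09096, unrefereed; with the discreteness of the spectrum of
`A_a` from Connes–Consani–Moscovici 2025): "For sufficiently small `a > 0`, the lowest eigenvalue `λ_a` is
positive, simple […]. Furthermore, the corresponding eigenfunction is even." Variational rendering in the tree's
normalisation (min–max, see the module docstring): there is `a₀ > 0` such that for `0 < a ≤ a₀` the ground energy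
`ε(a) = weilGroundEnergy a` is positive and the window-`a` clause `WeilWindowSimpleEven a` holds (odd normalised
test functions on `[−a,a]`, and even ones orthogonal to the ground state, have `Re Q ≥ ε(a) + δ`). -/
@[claim "Suzuki2026" "under-review"]
def Suzuki2026_thm_1_4 : Prop :=
  ∃ a₀ : ℝ, 0 < a₀ ∧ ∀ a : ℝ, 0 < a → a ≤ a₀ → 0 < weilGroundEnergy a ∧ WeilWindowSimpleEven a

/-- CLAIM (**Suzuki 2026, Thm. 1.4, asymptotic part**, arXiv:2606.09096, unrefereed): "`λ_a` satisfies
`λ_a = log(1/a) + μ₁ − log(2π) + ψ(2) − 1 + O(a)` as `a → 0+`, for some constant `μ₁ > 0`" (`ψ` the digamma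
function; `ψ(2) − 1 = −γ`, written with `Real.eulerMascheroniConstant`). -/
@[claim "Suzuki2026" "under-review"]
def Suzuki2026_thm_1_4_asymptotic : Prop :=
  ∃ μ₁ : ℝ, 0 < μ₁ ∧ ∃ C a₀ : ℝ, 0 < a₀ ∧ ∀ a : ℝ, 0 < a → a ≤ a₀ →
    |weilGroundEnergy a -
        (Real.log (1 / a) + μ₁ - Real.log (2 * Real.pi) - Real.eulerMascheroniConstant)| ≤ C * a

/-! ## Consequences (proved from the facts) -/

/-- Under Suzuki's Thm. 1.4, the small-window clause of route WeilGroundState holds: there is `a₀ > 0` with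
`WeilWindowSimpleEven a` for all `0 < a ≤ a₀` — verbatim (`weilWindowSimpleEven_iff`) the item
`Summit.RiemannHypothesis.RiemannHypothesis.Theses.WeilGroundState.SmallWindowsSimpleEven`. [folklore] -/
theorem Suzuki2026_thm_1_4.smallWindowsSimpleEven (h : Suzuki2026_thm_1_4) :
    ∃ a₀ : ℝ, 0 < a₀ ∧ ∀ a : ℝ, 0 < a → a ≤ a₀ →
      ∃ φ : ℝ → ℂ, ∃ δ : ℝ, 0 < δ ∧ ∀ g : ℝ → ℂ, IsWeilTest g → tsupport g ⊆ Icc (-a) a →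
        ∫ t, ‖g t‖ ^ 2 = (1 : ℝ) →
          ((∀ t, g (-t) = -g t) ∨ ((∀ t, g (-t) = g t) ∧ ∫ t, starRingEnd ℂ (φ t) * g t = 0)) →
            weilGroundEnergy a + δ ≤ (weilQuadratic g).re := by
  obtain ⟨a₀, ha₀, h⟩ := h
  exact ⟨a₀, ha₀, fun a ha ha' => (h a ha ha').2⟩

/-- Under Suzuki's Thm. 1.4, Weil positivity holds strictly on small windows: `0 < ε(a)` for `0 < a ≤ a₀`
(Yoshida 1992 proved `ε(a) > 0` for small `a`; restated here as the first clause of the fact). [folklore] -/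
theorem Suzuki2026_thm_1_4.weilGroundEnergy_pos (h : Suzuki2026_thm_1_4) :
    ∃ a₀ : ℝ, 0 < a₀ ∧ ∀ a : ℝ, 0 < a → a ≤ a₀ → 0 < weilGroundEnergy a := by
  obtain ⟨a₀, ha₀, h⟩ := h
  exact ⟨a₀, ha₀, fun a ha ha' => (h a ha ha').1⟩

end Literature.NumberTheory.LFunctions
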